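import Summits.QuantumFields.YangMills.Theorems.BalabanUVNodesN12DirectSurjBoxGauge
import Literature.MathematicalPhysics.QuantumFieldTheory.Balaban1983to89.B14Eq213DetSet

/-!
# DAG node N12 [B15] — (P4)′ road, assembly preliminaries: inner end-points of constrained rows, the host rule, the [III] (2.13) collar around inner sites

Cell `pub-ymgap` (HUMAN RULINGS D-0062 ∕ D-0149), width seat `pub-ymgap-dag-n12-w6` g6 (director-ym R463-ym; target = dag-n12-c's (P4)′ socket of record, INBOX l.42120).  Key K1⁹
`stmt-QuantumFields-27364`, `--kind proof --supports … --as helper`; count-neutral; THEOREMS ONLY (0 `def`, 0 `sorry`).  Small lemmas consumed by the assembly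
`…N12DirectSurjHsurj` (split off for the 400-line lint).

CONTENTS.  `inner_endpoint_of_mem_bondsOf_Bj` (every constrained bond of level `j ≥ 1` of `𝐁_k(Z)` has an end-point over `Ω_j(Z)`: `Γ_j ⊆ Ω_j`), `near_of_endpoint` (the end-points of a
bond touching `y` are among `y, y ± e_ν`), `exists_host` (the host rule: prefer an inner end-point, among two the larger label), `sqrt_sum_sq_le` (`√Σ‖f b‖² ≤ √#ι·‖f‖`),
`three_mul_pow_lt_sitesPerDir` (no wrap-around of the `3L^j`-boxes for `j ≤ k`, `k+1 ≤ m+K`), `cover_mem_of_near_inner` ([III] (2.13) collar: a cover point within sup-distance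
`L^j + (L^j−1)∕2` of `lift (ι_j y)`, `y` an inner `j`-site, projects into `Ω_{j−1}(Z) ⊆ Z` when `M₁ ≥ 2`).

HONEST FRAMING.  Bookkeeping by name; per-height ∕ per-instance EXISTENCE constants (print's (46)∕(83) are explicit and volume-uniform — NOT claimed); nothing of
Bałaban's asserted; N12 NOT discharged; K1⁹ NOT closed; count-neutral (typed 28∕28 · discharged 5∕27 unmoved); R4 closes only the conditional finite-`𝕋⁴` rung
`BalabanLadder.UV`; the YM mass gap (Clay) is NOT proved by any of this.
-/

noncomputable section

open scoped BigOperators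

namespace Summit.QuantumFields.YangMills.BalabanUVNodes.N12DirectSurjHsurjPrelim

open Literature.MathematicalPhysics.QuantumFieldTheory.Balaban1983to89
open B15DeterminingSets
open B14.Eq213DetSet (Bj maxDomT Bj_apply maxDomT_subset dist_maxDomT)
open B14.Eq213MaximalDomains (side)
open B15Eq112TorusCover (lift cover cover_lift)
open B10StarCount (unshift_shift)

section Small

variable {P : Params}

/-- Every constrained bond of level `j ≥ 1` of `𝐁_k(Z)` has an INNER end-point (`ι_j w ∈ Ω_j(Z)`): `Γ_j = Ω_j ∖ Ω_{j+1}` (`j < k`), `Γ_k = Ω_k`. [cite: Balaban1988Convergent, (2.2) p.255, (2.13) pp.256-257] -/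
theorem inner_endpoint_of_mem_bondsOf_Bj {M₁ : ℕ} {Z : Set (Site P 0)} {k j : ℕ} (hj : 1 ≤ j) (hjk : j ≤ k) {c : PBond P j}
    (hc : c ∈ bondsOf (Bj M₁ Z k j)) : embIter j c.src ∈ maxDomT M₁ Z j ∨ embIter j c.tgt ∈ maxDomT M₁ Z j := by
  have key : ∀ w : Site P j, w ∈ Bj M₁ Z k j → embIter j w ∈ maxDomT M₁ Z j := fun w hw => by
    rw [Bj_apply, mem_pts] at hw
    rcases hjk.eq_or_lt with rfl | hlt
    · rw [gammaRegion_self] at hw; exact hw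
    · rw [gammaRegion_mid _ hj hlt] at hw; exact hw.1
  rcases hc with h | h
  · exact Or.inl (key _ h)
  · exact Or.inr (key _ h)

/-- The two end-points of a bond touching `y` are among `y, y ± e_ν`. [folklore] -/
theorem near_of_endpoint {j : ℕ} (c : PBond P j) {y : Site P j} (hy : c.src = y ∨ c.tgt = y) (q : Site P j) (hq : q = c.src ∨ q = c.tgt) :
    q = y ∨ ∃ ν, q = y.shift ν ∨ q = y.unshift ν := by
  rcases hy with h | h <;> rcases hq with rfl | rfl
  · exact Or.inl h
  · exact Or.inr ⟨c.dir, Or.inl (by rw [← h]; rfl)⟩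
  · refine Or.inr ⟨c.dir, Or.inr ?_⟩
    rw [← h]
    exact (unshift_shift c.src c.dir).symm
  · exact Or.inl h

/-- The HOST rule (pure bookkeeping): among the two end-points prefer an inner one, and among two inner ones the one with the larger label. [folklore] -/
theorem exists_host {α : Type*} (inner : α → Prop) (φ : α → ℕ) :
    ∃ host : α → α → α, (∀ a b, host a b = a ∨ host a b = b) ∧ (∀ a b, (inner a ∨ inner b) → inner (host a b)) ∧
      (∀ a b y, inner y → (a = y ∨ b = y) → φ y ≤ φ (host a b)) := by
  classical
  refine ⟨fun a b => if inner a then (if inner b then (if φ a ≤ φ b then b else a) else a) else b, fun a b => ?_, fun a b h => ?_,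
    fun a b y hy hab => ?_⟩
  · by_cases h1 : inner a <;> by_cases h2 : inner b <;> by_cases h3 : φ a ≤ φ b <;> simp only [h1, h2, h3, if_true, if_false] <;> simp
  · by_cases h1 : inner a <;> by_cases h2 : inner b <;> by_cases h3 : φ a ≤ φ b <;> simp only [h1, h2, h3, if_true, if_false]
    <;> simp_all
  · rcases hab with rfl | rfl
    · by_cases h2 : inner b <;> by_cases h3 : φ a ≤ φ b <;> simp only [hy, h2, h3, if_true, if_false] <;> exact le_rfl
    · by_cases h1 : inner a <;> by_cases h3 : φ a ≤ φ b <;> simp only [hy, h1, h3, if_true, if_false]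
      <;> first | exact le_rfl | exact (lt_of_not_ge h3).le

/-- `√(Σ_b ‖f b‖²) ≤ √#ι · ‖f‖` (sup norm). [folklore] -/
theorem sqrt_sum_sq_le {ι E : Type*} [Fintype ι] [SeminormedAddCommGroup E] (f : ι → E) :
    Real.sqrt (∑ b, ‖f b‖ ^ 2) ≤ Real.sqrt (Fintype.card ι) * ‖f‖ := by
  have h1 : ∑ b, ‖f b‖ ^ 2 ≤ (Fintype.card ι : ℝ) * ‖f‖ ^ 2 := by
    calc ∑ b, ‖f b‖ ^ 2 ≤ ∑ _b : ι, ‖f‖ ^ 2 := Finset.sum_le_sum fun b _ => pow_le_pow_left₀ (norm_nonneg _) (norm_le_pi_norm f b) 2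
      _ = (Fintype.card ι : ℝ) * ‖f‖ ^ 2 := by rw [Finset.sum_const, Finset.card_univ, nsmul_eq_mul]
  calc Real.sqrt (∑ b, ‖f b‖ ^ 2) ≤ Real.sqrt ((Fintype.card ι : ℝ) * ‖f‖ ^ 2) := Real.sqrt_le_sqrt h1
    _ = Real.sqrt (Fintype.card ι) * ‖f‖ := by rw [Real.sqrt_mul (Nat.cast_nonneg _), Real.sqrt_sq (norm_nonneg _)]

/-- No wrap-around of the `3L^j`-boxes: `3·L^j < 2·L^{m+K} = #sites per direction` for `j ≤ k`, `k + 1 ≤ m + K` (`L ≥ 2`). [folklore] -/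
theorem three_mul_pow_lt_sitesPerDir {k j : ℕ} (hkK : k + 1 ≤ P.m + P.K) (hj : j ≤ k) : 3 * P.L ^ j < P.sitesPerDir 0 := by
  have hL2 : 2 ≤ P.L := P.hL.2
  have h1 : P.L ^ j ≤ P.L ^ k := Nat.pow_le_pow_right P.L_pos hj
  have h2 : P.L ^ (k + 1) ≤ P.L ^ (P.m + P.K - 0) := Nat.pow_le_pow_right P.L_pos (by omega)
  have h3 : P.L ^ (k + 1) = P.L ^ k * P.L := pow_succ _ _
  have h4 : P.L ^ k * 2 ≤ P.L ^ k * P.L := Nat.mul_le_mul_left _ hL2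
  have h5 : 1 ≤ P.L ^ k := Nat.one_le_pow _ _ P.L_pos
  show 3 * P.L ^ j < 2 * P.L ^ (P.m + P.K - 0)
  rw [h3] at h2
  omega

/-- [III] (2.13) collar: a cover point within sup-distance `L^j + (L^j−1)∕2` of `lift (ι_j y)`, `y` an INNER `j`-site (`ι_j y ∈ Ω_j(Z)`, `1 ≤ j ≤ k`), projects into `Z` — indeed into
`Ω_{j−1}(Z)`, since `dist(Ω_j, Ω_{j−1}ᶜ) ≥ L^j·M₁ − 1 ≥ 2L^j − 1` for `M₁ ≥ 2` (`B14.Eq213DetSet.dist_maxDomT`). [cite: Balaban1988Convergent, (2.13) pp.256-257] -/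
theorem cover_mem_of_near_inner {M₁ : ℕ} (hM2 : 2 ≤ M₁) {Z : Set (Site P 0)} {k j : ℕ} (hdiv : side P.L M₁ k ∣ P.sitesPerDir 0)
    (hj1 : 1 ≤ j) (hjk : j ≤ k) {y : Site P j} (hy : embIter j y ∈ maxDomT M₁ Z j) (z : Fin P.d → ℤ)
    (hz : ∀ κ, |z κ - lift P (embIter j y) κ| ≤ ((P.L ^ j : ℕ) : ℤ) + (((P.L ^ j - 1) / 2 : ℕ) : ℤ)) : cover P z ∈ Z := by
  have hM1 : 1 ≤ M₁ := le_trans one_le_two hM2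
  obtain ⟨n, rfl⟩ : ∃ n, j = n + 1 := ⟨j - 1, by omega⟩
  have hx : cover P (lift P (embIter (n + 1) y)) ∈ maxDomT M₁ Z (n + 1) := by rw [cover_lift]; exact hy
  have hnat : P.L ^ (n + 1) + (P.L ^ (n + 1) - 1) / 2 + 1 ≤ side P.L M₁ (n + 1) := by
    have h1 : (P.L ^ (n + 1) - 1) / 2 ≤ P.L ^ (n + 1) - 1 := Nat.div_le_self _ _
    have h2 : P.L ^ (n + 1) * 2 ≤ side P.L M₁ (n + 1) := by unfold side; exact Nat.mul_le_mul_left _ hM2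
    have h3 : 1 ≤ P.L ^ (n + 1) := Nat.one_le_pow _ _ P.L_pos
    omega
  have hint : ((P.L ^ (n + 1) : ℕ) : ℤ) + (((P.L ^ (n + 1) - 1) / 2 : ℕ) : ℤ) ≤ ((side P.L M₁ (n + 1) : ℕ) : ℤ) - 1 := by
    have h : ((P.L ^ (n + 1) : ℕ) : ℤ) + (((P.L ^ (n + 1) - 1) / 2 : ℕ) : ℤ) + 1 ≤ ((side P.L M₁ (n + 1) : ℕ) : ℤ) := by exact_mod_cast hnat
    linarith
  have hw : B14DomainGeom.Within ((side P.L M₁ (n + 1) : ℤ) - 1) (lift P (embIter (n + 1) y)) z := fun κ => by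
    rw [abs_sub_comm]; exact (hz κ).trans hint
  exact maxDomT_subset hM1 Z n (dist_maxDomT hM1 hdiv hjk hx hw)

end Small

end Summit.QuantumFields.YangMills.BalabanUVNodes.N12DirectSurjHsurjPrelim

end
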